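import Summits.BirchSwinnertonDyer.Rank1Residual.X1.LocalPackageRatStrict
import Summits.BirchSwinnertonDyer.Rank1Residual.X1.GeneratorCountLayerAtPStrict
import Summits.BirchSwinnertonDyer.Rank1Residual.Additive.ZpTowerSelmerTransport
import HarnessLib

/-!
# Route M's generator COUNT at LAYER `n`, IX: THE LOCAL TERM `a = 2` AT THE PRIME ABOVE `p`
# SUPPLIED — `p^{#T₀ + 2} ≤ p^{λ + pⁿμ} · (#E[p^∞]^{Γ_ℚ})²` with NO local-package hypothesis
# (cell `b2b-bsdres`, unit `b2b-bsdres-eisenstein-p1`, gen 20; X1R0-GAPMAP §29; memo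
# `V76-LOCAL-TERM-PLAN.md` §5.2 — (M1-local) CLOSED IN THE KERNEL)

HONEST FRAMING (run/shared/lean/b2b/bsd-rank1-residual/, verbatim in every file): the goal of the
cell is to DELETE the COMBINATION-SHAPED residual classes of the Birch–Swinnerton-Dyer formula for
ALL analytic-rank `≤ 1` elliptic curves over `ℚ` — "full BSD formula for every rank `≤ 1` curve in
class `C`" assembled STRICTLY from published theorems — so that the rank-`≤ 1` remainder becomes
exactly the CONSTRUCTION-SHAPED classes, which are TYPED (missing-input `Prop`s), NOT attempted.
This is not "finishing BSD". Sub-cell `b2b-bsdres-eisenstein-p1` (CLASS-OWNERS row "X1 (r = 0)"):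
research route; NO CLAIM BEYOND STATED CLASSES; nothing here changes a label; nothing is booked.
THEOREMS ONLY — no definition, no named fact, no typed input introduced. The PUBLISHED inputs remain
HYPOTHESES exactly as in FILE 24b (`X1/GeneratorCountLayerAtPStrict`): Greenberg's Prop. 2.4
(`hGrK`, typed `imKummer_ge_strictCondition_goodOrdinary`), the Poitou–Tate family over `ℚ_n`
(`inv`, `hperf`, `hsum`, `hcompl`) and Tate's local Euler–Poincaré characteristic at the places of
`ℚ_n` (`hEP`); nothing about any particular curve is asserted.

## What and why

FILE 24b (`pow_card_add_le_pow_mul_sq_of_strict_of_ordinary`) proved the layer-`n` count of route M,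
`p^{#T₀ + e} ≤ p^{λ(X) + pⁿμ(X)} · (#E[p^∞]^{Γ_ℚ})²`, GIVEN the local package at the prime `wp` of
`ℚ_n` above `p`: a subgroup `𝓛 ⊇ 𝓚_wp` of `H¹((ℚ_n)_wp, E[p])` with `p^e · #𝓚_wp ≤ #𝓛` all of whose
classes are strict at `p` (`hstrict`). This file SUPPLIES the package with `e = 2` for `E/ℚ` with a
RATIONAL POINT OF ORDER `p` (the 11 layer-1 classes of X1R0-GAPMAP §26–§28 all have `E(ℚ)[p] ≠ 0`):
the place `wp` and the factorisation data `(ι₂, ι', τ, hfix)` are constructed from the chosen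
embeddings (n1011's `exists_place_factorisation`, the generic local step of
`Additive/ZpTowerSelmerTransport`), and `X1/LocalPackageRatStrict.exists_strict_addSubgroup` is the
package (`X1/LocalPackageRat` + `X1/LocalPackageRatStrict`).

* **`pow_card_add_two_le_pow_mul_sq`**: `p^{#T₀ + 2} ≤ p^{λ(X) + pⁿμ(X)} · (#E[p^∞]^{Γ_ℚ})²`
  (no `[NumberField ℚ_n]` hypothesis: the tree's instance `ZpExtension.numberField_layer`).

So the kernel now contains X1R0-GAPMAP §14.1's `t_n + a − 2δ ≤ λ + pⁿμ` with `a = 2` at every layer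
`n` for these curves; for the 11 classes (`n = 1`, `p = 3`) the count side is thereby reduced to the
census certificates (Tamagawa witnesses `T₀` over `ℚ_1`) and the typed published inputs.

References: [GreenbergLNM1716] §2 Prop. 2.4, §3 Lemma 3.1, Lemma 3.4 (p. 89), §5 pp. 114–118, p. 137;
[MilneADT2006] I Thm. 2.8, Thm. 4.10; [SerreGaloisCohomology1997] II.§1.1; X1R0-GAPMAP §14.1, §26–§29.
-/

noncomputable section

open scoped Classical NNReal

open Function Field NumberField IsDedekindDomain WeierstrassCurve PowerSeries
  Literature.NumberTheory.EllipticCurves Literature.NumberTheory.GaloisRepresentations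
  Literature.NumberTheory.GaloisCohomology Summit.BirchSwinnertonDyer.Rank1Residual.GaloisImage
  Literature.NumberTheory.EllipticCurves.IwasawaAlgebra
  Summit.BirchSwinnertonDyer.Rank1Residual.Additive
  Summit.BirchSwinnertonDyer.Rank1Residual.Additive.ZpTower
  Summit.BirchSwinnertonDyer.Rank1Residual.Additive.LocalTransport
  Summit.BirchSwinnertonDyer.Rank1Residual.X1.GeneratorBoundMuLayer
open Literature.NumberTheory.GaloisRepresentations.DiscreteGaloisModule (SelmerStructure unramifiedSubgroup)
open Literature.NumberTheory.EllipticCurves.Greenberg1999 (imKummer_ge_strictCondition_goodOrdinary)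
open Literature.NumberTheory.EllipticCurves.GreenbergSelmer (inertiaIn inertiaInToH)
open Summit.BirchSwinnertonDyer.Rank1Residual.X2.GreenbergVatsalReductionDatum (localRed)

set_option autoImplicit false

namespace Summit.BirchSwinnertonDyer.Rank1Residual.X1.GeneratorCountLayerAtPLocal

/-! ## §1. The factorisation data at a place of `K_n` above `v` cut out by the embeddings -/

section Factorisation

variable {K : Type} [Field K] [NumberField K] {p : ℕ} [Fact p.Prime] (κ : ZpExtension K p) (n : ℕ)

/-- **Factorisation of the chosen embeddings** (n1011, `exists_place_factorisation` + the generic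
local step of `Additive/ZpTowerSelmerTransport`): for a finite place `v` of a number field `K` with a
`ℤ_p`-extension `κ` there are a place `wp ∣ v` of the layer `K_n`, an isomorphism
`ι₂ : \bar K_v ≃+* \bar{(K_n)_wp}` over `K_v → (K_n)_wp`, a `K_n`-embedding `ι' : \bar K_n → \bar{(K_n)_wp}`
with `ι' ∘ ι_{K_n} = ι₂ ∘ ι_{K_v}`, differing from the chosen one by some `τ ∈ Γ_{K_n}`, such that every
`h ∈ Γ_{K_v}` restricting into `Gal(\bar K/K_n)` fixes `ι₂⁻¹((K_n)_wp)`.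
[cite: SerreGaloisCohomology1997, II.§1.1] [cite: NeukirchANT1999, II.§8] -/
theorem exists_factorisation (v : HeightOneSpectrum (𝓞 K)) :
    ∃ (wp : HeightOneSpectrum (𝓞 (κ.layer n))) (_ : wp.asIdeal.LiesOver v.asIdeal)
      (ι₂ : AlgebraicClosure (v.adicCompletion K) ≃+* AlgebraicClosure (wp.adicCompletion (κ.layer n)))
      (ι' : AlgebraicClosure (κ.layer n) →ₐ[κ.layer n] AlgebraicClosure (wp.adicCompletion (κ.layer n)))
      (τ : Field.absoluteGaloisGroup (κ.layer n)),
      (∀ x : v.adicCompletion K,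
        ι₂ (algebraMap (v.adicCompletion K) (AlgebraicClosure (v.adicCompletion K)) x) =
          algebraMap (wp.adicCompletion (κ.layer n)) (AlgebraicClosure (wp.adicCompletion (κ.layer n)))
            (adicCompletionMap (K := K) (κ.layer n) v wp x)) ∧
      (∀ z : AlgebraicClosure K,
        ι' (closureEmb (K := K) (κ.layer n) z) = ι₂ (closureEmb (K := K) (v.adicCompletion K) z)) ∧
      (∀ h : absoluteGaloisGroup (v.adicCompletion K),
        resGalOfEmb (closureEmb (K := K) (v.adicCompletion K)) h ∈ κ.layerSubgroup n →
        ∀ y : wp.adicCompletion (κ.layer n),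
          (show AlgebraicClosure (v.adicCompletion K) ≃ₐ[v.adicCompletion K]
              AlgebraicClosure (v.adicCompletion K) from h)
            (ι₂.symm (algebraMap _ (AlgebraicClosure (wp.adicCompletion (κ.layer n))) y)) =
            ι₂.symm (algebraMap _ (AlgebraicClosure (wp.adicCompletion (κ.layer n))) y)) ∧
      ι' = (closureEmb (K := κ.layer n) (wp.adicCompletion (κ.layer n))).comp
        ((show AlgebraicClosure (κ.layer n) ≃ₐ[κ.layer n] AlgebraicClosure (κ.layer n) from τ) :
          AlgebraicClosure (κ.layer n) →ₐ[κ.layer n] AlgebraicClosure (κ.layer n)) := by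
  set ι := closureEmb (K := K) (v.adicCompletion K) with hιdef
  let ιL : AlgebraicClosure K ≃ₐ[K] AlgebraicClosure (κ.layer n) :=
    algEquivOfEmb (κ.layer n) (closureEmb (K := K) (κ.layer n))
  -- the embedding `K_n → \bar K_v` and its factorisation through some `(K_n)_wp`
  let φ : κ.layer n →+* AlgebraicClosure (v.adicCompletion K) :=
    ι.toRingHom.comp ((ιL.symm : AlgebraicClosure (κ.layer n) →+* AlgebraicClosure K).comp
      (algebraMap (κ.layer n) (AlgebraicClosure (κ.layer n))))
  have hφapply : ∀ l, φ l = ι (ιL.symm (algebraMap (κ.layer n) (AlgebraicClosure (κ.layer n)) l)) :=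
    fun _ ↦ rfl
  have hφ : φ.comp (algebraMap K (κ.layer n)) =
      (algebraMap (v.adicCompletion K) (AlgebraicClosure (v.adicCompletion K))).comp
        (algebraMap K (v.adicCompletion K)) := by
    ext x
    change φ (algebraMap K (κ.layer n) x) =
      algebraMap (v.adicCompletion K) _ (algebraMap K (v.adicCompletion K) x)
    rw [hφapply, ← IsScalarTower.algebraMap_apply K (κ.layer n) (AlgebraicClosure (κ.layer n)),
      AlgEquiv.commutes, AlgHom.commutes, ← IsScalarTower.algebraMap_apply]
  obtain ⟨wp, hwp, ε, hεf, hεφ⟩ := exists_place_factorisation (κ.layer n) v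
    (algebraMap (v.adicCompletion K) (AlgebraicClosure (v.adicCompletion K))) φ hφ
  -- (the `LiesOver` instance restated at `ℚ`: the factorisation lemma is `K`-general, and its
  -- `Algebra ℚ ℚ_n` is the layer's `IntermediateField.algebra`, not `DivisionRing.toRatAlgebra`)
  haveI hwpv : wp.asIdeal.LiesOver v.asIdeal := hwp
  set E := v.adicCompletion K with hE
  set E' := wp.adicCompletion (κ.layer n) with hE'
  set f := adicCompletionMap (K := K) (κ.layer n) v wp with hf
  have hεL : ∀ l : κ.layer n, ε (algebraMap (κ.layer n) E' l) =
      ι (ιL.symm (algebraMap (κ.layer n) (AlgebraicClosure (κ.layer n)) l)) :=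
    fun l ↦ (RingHom.congr_fun hεφ l).trans (hφapply l)
  have hgen := closure_range_adicCompletionMap_union_eq_top (κ.layer n) v wp
  -- `\bar K_v` as an algebraic `E'`-algebra through `ε`, and `ι₂ : \bar K_v ≃ \bar E'` over `E'`
  letI : Algebra E' (AlgebraicClosure E) := ε.toAlgebra
  letI : Algebra E E' := f.toAlgebra
  haveI : IsScalarTower E E' (AlgebraicClosure E) :=
    IsScalarTower.of_algebraMap_eq fun a ↦ (RingHom.congr_fun hεf a).symm
  haveI : Algebra.IsAlgebraic E' (AlgebraicClosure E) := Algebra.IsAlgebraic.tower_top (K := E) E'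
  let ι₂₀ : AlgebraicClosure E →ₐ[E'] AlgebraicClosure E' := IsAlgClosed.lift
  have hι₂bij : Function.Bijective ι₂₀ := by
    letI : Algebra (AlgebraicClosure E) (AlgebraicClosure E') := ι₂₀.toRingHom.toAlgebra
    haveI : IsScalarTower E' (AlgebraicClosure E) (AlgebraicClosure E') :=
      IsScalarTower.of_algebraMap_eq fun y ↦ (ι₂₀.commutes y).symm
    haveI : Algebra.IsAlgebraic (AlgebraicClosure E) (AlgebraicClosure E') :=
      Algebra.IsAlgebraic.tower_top (K := E') (AlgebraicClosure E)
    exact IsAlgClosed.algebraMap_bijective_of_isIntegral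
      (k := AlgebraicClosure E) (K := AlgebraicClosure E')
  let ι₂ : AlgebraicClosure E ≃+* AlgebraicClosure E' := RingEquiv.ofBijective ι₂₀.toRingHom hι₂bij
  have hι₂ε : ∀ y : E', ι₂ (ε y) = algebraMap E' (AlgebraicClosure E') y := fun y ↦ ι₂₀.commutes y
  have hι₂symm : ∀ y : E', ι₂.symm (algebraMap E' (AlgebraicClosure E') y) = ε y := fun y ↦ by
    rw [← hι₂ε, RingEquiv.symm_apply_apply]
  have hι₂ : ∀ x : E, ι₂ (algebraMap E (AlgebraicClosure E) x) = algebraMap E' _ (f x) := by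
    intro x
    rw [← hι₂ε, ← RingHom.congr_fun hεf x]
    rfl
  -- `ι' = ι₂ ∘ ι ∘ ι_L⁻¹ : \bar K_n → \bar E'` over `K_n`
  have hι'L : ∀ l : κ.layer n,
      ι₂ (ι (ιL.symm (algebraMap (κ.layer n) (AlgebraicClosure (κ.layer n)) l))) =
        algebraMap (κ.layer n) (AlgebraicClosure E') l := fun l ↦ by
    rw [← hεL l, hι₂ε, ← IsScalarTower.algebraMap_apply]
  let ι' : AlgebraicClosure (κ.layer n) →ₐ[κ.layer n] AlgebraicClosure E' :=
    { ι₂.toRingHom.comp (ι.toRingHom.comp (ιL.symm : AlgebraicClosure (κ.layer n) →+*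
        AlgebraicClosure K)) with
      commutes' := fun l ↦ hι'L l }
  have hι'apply : ∀ z', ι' z' = ι₂ (ι (ιL.symm z')) := fun _ ↦ rfl
  have hcompat : ∀ z, ι' (closureEmb (K := K) (κ.layer n) z) = ι₂ (ι z) := fun z ↦ by
    rw [hι'apply, ← algEquivOfEmb_apply (κ.layer n) (closureEmb (K := K) (κ.layer n)) z,
      AlgEquiv.symm_apply_apply]
  -- elements of `Γ_E` restricting into `Gal(\bar K/K_n)` fix `ι₂⁻¹(E') = ε(E')`
  have hfix : ∀ h : Field.absoluteGaloisGroup E, resGalOfEmb ι h ∈ κ.layerSubgroup n → ∀ y : E',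
      (show AlgebraicClosure E ≃ₐ[E] AlgebraicClosure E from h)
        (ι₂.symm (algebraMap E' (AlgebraicClosure E') y)) =
          ι₂.symm (algebraMap E' (AlgebraicClosure E') y) := by
    intro h hh y
    rw [← galRange_layer_eq_layerSubgroup κ n] at hh
    obtain ⟨σ', hσ'⟩ := hh
    rw [hι₂symm]
    have hσ : resGal (K := K) (κ.layer n) σ' = resGalOfEmb ι h := hσ'
    have key : (((show AlgebraicClosure E ≃ₐ[E] AlgebraicClosure E from h) :
        AlgebraicClosure E →+* AlgebraicClosure E).comp ε) = ε := by
      refine RingHom.eq_of_eqOn_set_dense hgen ?_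
      rintro _ (⟨a, rfl⟩ | ⟨l, rfl⟩)
      · have hfa : ε (f a) = algebraMap E (AlgebraicClosure E) a := RingHom.congr_fun hεf a
        change (show AlgebraicClosure E ≃ₐ[E] AlgebraicClosure E from h) (ε (f a)) = ε (f a)
        rw [hfa]
        exact AlgEquiv.commutes _ a
      · have hz : (show AlgebraicClosure K ≃ₐ[K] AlgebraicClosure K from resGalOfEmb ι h)
            (ιL.symm (algebraMap (κ.layer n) (AlgebraicClosure (κ.layer n)) l)) =
            ιL.symm (algebraMap (κ.layer n) (AlgebraicClosure (κ.layer n)) l) := by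
          apply ιL.injective
          rw [← hσ]
          have e := algEquivOfEmb_resGal_apply (κ.layer n) σ'
            (ιL.symm (algebraMap (κ.layer n) (AlgebraicClosure (κ.layer n)) l))
          refine e.trans ?_
          change (show AlgebraicClosure (κ.layer n) ≃ₐ[κ.layer n] AlgebraicClosure (κ.layer n)
            from σ') (ιL (ιL.symm _)) = ιL (ιL.symm _)
          rw [AlgEquiv.apply_symm_apply, AlgEquiv.commutes]
        change (show AlgebraicClosure E ≃ₐ[E] AlgebraicClosure E from h)
          (ε (algebraMap (κ.layer n) E' l)) = ε (algebraMap (κ.layer n) E' l)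
        rw [hεL l]
        exact (apply_resGalAuxOfEmb_apply ι h _).symm.trans (congrArg ι hz)
    exact RingHom.congr_fun key y
  -- `ι'` differs from the chosen embedding by some `τ ∈ Γ_{K_n}`
  obtain ⟨τ, hτ⟩ := exists_algHom_eq_comp (closureEmb (K := κ.layer n) E') ι'
  exact ⟨wp, hwp, ι₂, ι', τ, hι₂, hcompat, hfix, hτ⟩

end Factorisation

variable (W : WeierstrassCurve ℚ) [W.IsElliptic] [W.IsGloballyMinimal] {p : ℕ} [hp : Fact p.Prime]
  (κ : ZpExtension ℚ p) (n : ℕ) (κn : ZpExtension (κ.layer n) p)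
  (hκn : ∀ σ : Field.absoluteGaloisGroup (κ.layer n),
    (κn σ).toAdd * (p : ℤ_[p]) ^ n = (κ (resGal (K := ℚ) (κ.layer n) σ)).toAdd)
  {γ : Field.absoluteGaloisGroup ℚ} (D : W.SelmerDualData κ γ)

/-! ## §2. The layer-`n` count with the local term `a = 2` -/

set_option maxHeartbeats 400000 in -- the `K`-general factorisation data are matched against the
-- `ℚ`-level package hypotheses through the two `Algebra ℚ ℚ_n` instance paths (defeq beyond
-- `instances` transparency only); each such unification is expensive.
include hκn in
/-- **ROUTE M AT LAYER `n`, LOCAL TERM `a = 2` SUPPLIED**: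
`p^{#T₀ + 2} ≤ p^{λ(X) + pⁿμ(X)} · (#E[p^∞]^{Γ_ℚ})²`. `E/ℚ` globally minimal, `p` odd with
`p ∤ Δ_E`, `p ∤ a_p` and a RATIONAL POINT OF ORDER `p`; `κ` cyclotomic with layer `ℚ_n` and restricted
tower `κ_n`; `D` any dual datum of `Sel_{p^∞}(E/ℚ_∞)` with `X` finitely generated torsion without
non-zero finite submodules; a Poitou–Tate family and Tate's local Euler–Poincaré characteristic over
`ℚ_n`; `T₀` places `w ∤ p` of `ℚ_n` with Tamagawa witnesses; Greenberg's Prop. 2.4 BY NAME (`hGrK`).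
FILE 24b with the local package `(𝓛, 𝓚 ≤ 𝓛, p²·#𝓚 ≤ #𝓛, hstrict)` at the prime of `ℚ_n` above
`p` DISCHARGED (`X1/LocalPackageRat`, `X1/LocalPackageRatStrict`, and the factorisation §1). [cite: GreenbergLNM1716, §2 Prop. 2.4, §3 Lemma 3.1,
Lemma 3.4 (p. 89), §5 pp. 114–118, p. 137] [cite: MilneADT2006, I Thm. 2.8] -/
theorem pow_card_add_two_le_pow_mul_sq [Module.Finite (IwasawaAlgebra p) D.X]
    (hgood : W.HasGoodReductionAtPrime p)
    (hX : D.IsTorsion) (hnf : ∀ N : Submodule (IwasawaAlgebra p) D.X, Finite N → N = ⊥)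
    (hodd : p ≠ 2) (hκ : κ.IsCyclotomic) (hGrK : imKummer_ge_strictCondition_goodOrdinary)
    (v : HeightOneSpectrum (𝓞 ℚ)) (hpv : ((p : ℕ) : 𝓞 ℚ) ∈ v.asIdeal)
    (hΔ : ¬ (p : ℤ) ∣ minimalDiscriminantInt W) (hord : ¬ (p : ℤ) ∣ W.frobeniusTrace p)
    (hT : ∃ T : W.toAffine.Point, addOrderOf T = p)
    (inv : LocalInvariants (κ.layer n) p) (hperf : inv.IsPerfect) (hsum : inv.SumLocalTermEqZero)
    (hcompl : inv.SelmerComplement)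
    (hEP : ∀ w : HeightOneSpectrum (𝓞 (κ.layer n)),
      localEulerPoincareCharacteristic (w.adicCompletion (κ.layer n)))
    (T₀ : Finset (HeightOneSpectrum (𝓞 (κ.layer n))))
    (hT₀p : ∀ w ∈ T₀, ((p : ℕ) : 𝓞 (κ.layer n)) ∉ w.asIdeal)
    (hwit : ∀ w ∈ T₀, ∃ u ∈ unramifiedSubgroup
        (((W.baseChange (κ.layer n)).torsionGaloisModule (p : ℤ)).restrictField
          (w.adicCompletion (κ.layer n))) 1,
      u ∉ (W.baseChange (κ.layer n)).kummerLocalConditionAt (p : ℤ) (w.adicCompletion (κ.layer n))) :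
    p ^ (T₀.card + 2) ≤ p ^ (lambdaInvariant p D.X + p ^ n * muInvariant p D.X) *
      Nat.card (MulAction.fixedPoints (Field.absoluteGaloisGroup ℚ) (geomPrimaryTorsion W p)) ^ 2 := by
  have hfact := exists_factorisation κ n v
  obtain ⟨wp, hwp, ι₂, ι', τ, hι₂, hcompat, hfix, hτ⟩ := hfact
  -- (the `LiesOver` instance restated at `ℚ`: the factorisation lemma is `K`-general, and its
  -- `Algebra ℚ ℚ_n` is the layer's `IntermediateField.algebra`, not `DivisionRing.toRatAlgebra`)
  haveI hwpv : wp.asIdeal.LiesOver v.asIdeal := hwp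
  have hpack := LocalPackageRatStrict.exists_strict_addSubgroup W κ n κn hκn hpv hΔ wp ι₂ hι₂ ι'
    hcompat hfix τ hτ hκ hodd hord hT (hEP wp)
  obtain ⟨𝓛wp, h𝓛, hidx, hstr⟩ := hpack
  -- `wp ∋ p`, so `wp ∉ T₀`
  have hpw : ((p : ℕ) : 𝓞 (κ.layer n)) ∈ wp.asIdeal := by
    have h1 : (algebraMap (𝓞 ℚ) (𝓞 (κ.layer n))) ((p : ℕ) : 𝓞 ℚ) ∈ wp.asIdeal := by
      rw [← Ideal.mem_comap]
      have h2 : v.asIdeal = wp.asIdeal.comap (algebraMap (𝓞 ℚ) (𝓞 (κ.layer n))) :=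
        Ideal.LiesOver.over
      rw [← h2]; exact hpv
    rwa [map_natCast] at h1
  have hwpT₀ : wp ∉ T₀ := fun h ↦ hT₀p wp h hpw
  -- the family of local conditions: `𝓛wp` at `wp` (FILE 24b uses no other place of the family)
  let 𝓛 : ∀ w : HeightOneSpectrum (𝓞 (κ.layer n)), AddSubgroup (galoisCohomology
      (((W.baseChange (κ.layer n)).torsionGaloisModule (p : ℤ)).toLocal (Sum.inr w)) 1) :=
    Function.update (fun _ ↦ ⊤) wp
      (show AddSubgroup (galoisCohomology (((W.baseChange (κ.layer n)).torsionGaloisModule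
        (p : ℤ)).toLocal (Sum.inr wp)) 1) from 𝓛wp)
  have h𝓛wp : 𝓛 wp = (show AddSubgroup (galoisCohomology (((W.baseChange (κ.layer n)).torsionGaloisModule
        (p : ℤ)).toLocal (Sum.inr wp)) 1) from 𝓛wp) := Function.update_self _ _ _
  refine GeneratorCountLayerAtPStrict.pow_card_add_le_pow_mul_sq_of_strict_of_ordinary W κ n κn hκn D
    hgood hX hnf hodd hκ hGrK v hpv hΔ hord inv hperf hsum hcompl hEP T₀ hT₀p hwit wp hwpT₀ hwpv 𝓛
    (by rw [h𝓛wp]; exact h𝓛) 2 (by rw [h𝓛wp]; exact hidx) fun y hy ↦ ?_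
  obtain ⟨φ, rfl⟩ := oneCocycleClass_surjective _ y
  rw [h𝓛wp] at hy
  exact ⟨φ, rfl, hstr φ hy⟩

end Summit.BirchSwinnertonDyer.Rank1Residual.X1.GeneratorCountLayerAtPLocal

end
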